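import Literature.InformationTheory.QuantumCodes.SmallSetFlipRelabel
import Literature.InformationTheory.QuantumCodes.QuantumExpanderThresholdMinMax
import Literature.InformationTheory.QuantumCodes.DepolarizingCSSDecoding
import Literature.InformationTheory.QuantumCodes.QuantumExpanderLTZTheorem2
import HarnessLib

/-!
# Quantum expander codes: the `Z`-sector IN THE CODE'S OWN COORDINATES, and both sectors at once
# (Fawzi–Grospellier–Leverrier 2018 Thm 1 / Prop 11, "the other case being symmetric")

Index of sources: `[cite: FawziGrospellierLeverrier2018]` = Fawzi–Grospellier–Leverrier, STOC 2018 /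
arXiv:1711.08351v2, §2.3 (p0008 L1-6: "a decoding algorithm is given by an `X`-decoding algorithm … and a
`Z`-decoding algorithm"; "`H_X = (I ⊗ H, Hᵀ ⊗ I)`, `H_Z = (H ⊗ I, I ⊗ Hᵀ)`"), Thm 1 (§1 p0004), Prop 11 (§3.2);
`[cite: LeverrierTillichZemor2015]` = Leverrier–Tillich–Zémor, FOCS 2015 / arXiv:1504.00822v1, §2–§3 (the two factor
graphs `𝒢_X`, `𝒢_Z` of `Q_G`, "the situation for `𝒢_Z` is obtained by exchanging the roles of `A` and `B`").

qec PARTITION v2 row 04 (`prover-qec-type-04`, gen 5). The tree's decoder theorems for the quantum expander code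
`Q_G` (`QuantumExpanderThresholdMinMax.lean`: `fgl18_theorem1_minmax`, `fgl18_proposition11_minmax_of_le`;
`…_transpose`) concern ONE sector: syndromes by `expanderHX H`, flips inside the rows of `expanderHZ H`; the
"`Z`-sector" was so far available only as the `X`-sector of the REVERSED graph `Hᵀ`, whose qubit set is
`(B×B) ⊕ (A×A)` rather than `Q_G`'s `(A×A) ⊕ (B×B)`. Here:

* `expanderHZ_eq_submatrix_swap`, `expanderHX_eq_submatrix_swap` — **the symmetry, exactly**: `H_Z(G)` is
  `H_X(Gᵀ)` and `H_X(G)` is `H_Z(Gᵀ)` read through the block swap `(A×A) ⊕ (B×B) ≃ (B×B) ⊕ (A×A)`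
  (`Equiv.sumComm`; no transposition of coordinates inside the blocks) — Tillich–Zémor's Poincaré duality `HypergraphProduct.xMatrix_eq_submatrix_swap` / `zMatrix_eq_submatrix_swap` specialised to `ℋ₂ = ℋ₁ᵀ`;
* `fgl18_proposition11_zsector`, `fgl18_theorem1_zsector` — **Prop 11 and Thm 1 for the `Z`-sector of `Q_G` in its
  own coordinates**: every small-set-flip decoder `D_Z` with syndrome matrix `expanderHZ H` and generator matrix
  `expanderHX H` (parameter `κ ≤ β̃·max(Δ_A,Δ_B)`) corrects every error of weight `≤ (r̃β̃/(1+β̃))·min(γ_A n_A, γ_B n_B)`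
  and has the Thm-1 failure bound under every locally stochastic `Z`-noise (transport of the `Hᵀ` statements along
  the swap, `SmallSetFlipRelabel.lean`);
* `fgl18_theorem1_both_sectors` — **the code as a whole**: ONE `p₀, C, C'` (depending on the degrees and expansion
  only) such that for every biregular expander `G`, every pair `(D_X, D_Z)` of small-set-flip decoders and every joint
  noise weight `ν` on pairs `(E_X, E_Z)` whose two marginals are locally stochastic of parameter `p < p₀`, the total
  weight of the pairs on which `D_X` or `D_Z` fails is `≤ 2·C·n·(p/p₀)^{C'√n}`, `n = n_A² + n_B²` (union bound; covers
  independent `X/Z` noise and depolarizing-type correlated noise through its marginals);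
* `fgl18_theorem1_depolarizing` — **i.i.d. depolarizing noise of rate `p`**: for the CSS code
  `CSSCode.ofMatrices (expanderHX H) (expanderHZ H)` decoded sector-wise by two small-set-flip decoders, the
  depolarizing failure probability (`CSSCode.depolarizingFailureProb`, `DepolarizingCSSDecoding.lean`) is
  `≤ 2·C·n·((2p/3)/p₀)^{C'√n}` whenever `2p/3 < p₀` — the two marginals are independent flips of rate `2p/3`
  (`CSSCode.depolarizingFailureProb_le`), each bounded by Thm 1; i.e. a depolarizing threshold `(3/2)·p₀`.

Letters: "`X`-sector" / "`Z`-sector" follow the tree's `QuantumExpanderCodes.lean` (the `X`-sector has syndrome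
matrix `expanderHX H`); in `CSSCode` language with `HX := expanderHX H` the `X`-sector decoder is the one that corrects
`Z`-TYPE errors and vice versa (LTZ15's and type-04's letters are opposite, as recorded there) — every statement below
names the two matrices explicitly, so no claim depends on the letters.

All statements PROVED (kernel axioms); no definitions, no named facts. Honest framing: a union bound for
sector-wise decoding, nothing about correlation-aware decoding; constants are those of `fgl18_theorem1_minmax`.
-/

namespace Literature.InformationTheory.QuantumCodes

namespace QuantumExpander

open Finset Matrix

variable {A B : Type*} [Fintype A] [Fintype B] [DecidableEq A] [DecidableEq B]

/-! ### The symmetry `H_Z(G) = H_X(Gᵀ) ∘ swap`, `H_X(G) = H_Z(Gᵀ) ∘ swap` -/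

omit [Fintype A] [Fintype B] in
/-- **`H_Z` of `Q_G` is `H_X` of `Q_{Gᵀ}` read through the block swap** of the qubit labels
`(A×A) ⊕ (B×B) ≃ (B×B) ⊕ (A×A)`: entrywise `H_Z(G)_{ba, q} = H_X(Gᵀ)_{ba, swap q}` ("`H_X = (I ⊗ H, Hᵀ ⊗ I)`,
`H_Z = (H ⊗ I, I ⊗ Hᵀ)`": replacing `H` by `Hᵀ` exchanges the two up to the order of the blocks).
[cite: FawziGrospellierLeverrier2018, §2.3 (H_X, H_Z of the hypergraph product; arXiv v2 p0008)] -/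
theorem expanderHZ_eq_submatrix_swap (H : Matrix B A (ZMod 2)) :
    expanderHZ H = (expanderHX Hᵀ).submatrix id (Equiv.sumComm (A × A) (B × B)) :=
  HypergraphProduct.xMatrix_eq_submatrix_swap H Hᵀ

omit [Fintype A] [Fintype B] in
/-- **`H_X` of `Q_G` is `H_Z` of `Q_{Gᵀ}` read through the block swap.**
[cite: FawziGrospellierLeverrier2018, §2.3 (H_X, H_Z of the hypergraph product; arXiv v2 p0008)] -/
theorem expanderHX_eq_submatrix_swap (H : Matrix B A (ZMod 2)) :
    expanderHX H = (expanderHZ Hᵀ).submatrix id (Equiv.sumComm (A × A) (B × B)) :=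
  HypergraphProduct.zMatrix_eq_submatrix_swap H Hᵀ

/-- Relabelling the coordinates does not change the Hamming weight. [folklore] -/
private theorem hammingNorm_comp_equiv' {Q Q' : Type*} [Fintype Q] [Fintype Q'] [DecidableEq Q]
    [DecidableEq Q'] (e : Q ≃ Q') (x : Q' → ZMod 2) : hammingNorm (x ∘ e) = hammingNorm x := by
  unfold hammingNorm
  have hset : (univ.filter fun i : Q => (x ∘ e) i ≠ 0) = (univ.filter fun i' : Q' => x i' ≠ 0).map e.symm.toEmbedding := by
    ext i
    simp only [Finset.mem_filter, Finset.mem_univ, true_and, Function.comp_apply, Finset.mem_map_equiv,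
      Equiv.symm_symm]
  rw [hset, Finset.card_map]

/-! ### Prop 11 and Thm 1 for the `Z`-sector of `Q_G` -/

/-- **FGL18 Proposition 11, `Z`-sector of `Q_G` in its own coordinates** (convention-free form): for a
`(Δ_A, Δ_B)`-biregular `(γ_A, δ_A, γ_B, δ_B)`-expanding `G` with `β̃ := betaZero (min Δ) (max Δ) δ_A δ_B > 0`, every
small-set-flip decoder `D_Z` for the pair (syndromes `H_Z = expanderHZ H`, generators `H_X = expanderHX H`) with
parameter `κ ≤ β̃·max(Δ_A,Δ_B)` corrects every `Z`-error of weight `≤ (min Δ/max Δ)·β̃/(1+β̃)·min(γ_A n_A, γ_B n_B)`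
("the other case being symmetric": it is Prop 11 for `Gᵀ`, transported along the block swap).
[cite: FawziGrospellierLeverrier2018, Prop 11 (§3.2) with §2.3 ("an X-decoding algorithm … and a Z-decoding algorithm"; arXiv v2 p0008 L1-6)] -/
theorem fgl18_proposition11_zsector (H : Matrix B A (ZMod 2)) {dA dB : ℕ} {γA δA γB δB : ℝ}
    (hreg : IsBiregular H dA dB) (hexp : IsLeftRightExpanding H dA dB γA δA γB δB)
    (hdA : 0 < dA) (hdB : 0 < dB) (hδA : 0 < δA) (hδB : 0 < δB)
    (hβ : 0 < betaZero (min dA dB) (max dA dB) δA δB)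
    {κ : ℝ} (hκ : κ ≤ betaZero (min dA dB) (max dA dB) δA δB * ((max dA dB : ℕ) : ℝ))
    {D : Decoder (B × A → ZMod 2) ((A × A) ⊕ (B × B) → ZMod 2)}
    (hD : IsSSFDecoder κ (expanderHZ H) (expanderHX H) D)
    {e : (A × A) ⊕ (B × B) → ZMod 2}
    (he : (hammingNorm e : ℝ) ≤
      ((min dA dB : ℕ) : ℝ) / ((max dA dB : ℕ) : ℝ) * betaZero (min dA dB) (max dA dB) δA δB
        / (1 + betaZero (min dA dB) (max dA dB) δA δB) * min (γA * Fintype.card A) (γB * Fintype.card B)) :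
    D.Corrects (fun x => expanderHZ H *ᵥ x)
      (rowSpace (expanderHX H) : Set ((A × A) ⊕ (B × B) → ZMod 2)) e := by
  set σ := Equiv.sumComm (A × A) (B × B) with hσ
  rw [expanderHZ_eq_submatrix_swap H, expanderHX_eq_submatrix_swap H] at hD ⊢
  have hD' := isSSFDecoder_comp_equiv σ hD
  have he' : (hammingNorm (e ∘ σ.symm) : ℝ) ≤
      ((min dA dB : ℕ) : ℝ) / ((max dA dB : ℕ) : ℝ) * betaZero (min dA dB) (max dA dB) δA δB
        / (1 + betaZero (min dA dB) (max dA dB) δA δB) * min (γA * Fintype.card A) (γB * Fintype.card B) := by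
    rwa [hammingNorm_comp_equiv' σ.symm e]
  have h := fgl18_proposition11_transpose H hreg hexp hdA hdB hδA hδB hβ hκ hD' he'
  exact (corrects_comp_equiv_iff σ D e).1 h

open Classical in
/-- **FGL18 Theorem 1, `Z`-sector of `Q_G` in its own coordinates**: for fixed degrees and expansion parameters with
`β₀ > 0` there are `p₀ > 0`, `C`, `C' > 0` such that for EVERY `(Δ_A,Δ_B)`-biregular expanding `G`, every parameter
`κ ≤ β̃·max(Δ_A,Δ_B)`, every small-set-flip decoder `D_Z` for (syndromes `expanderHZ H`, generators `expanderHX H`)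
and every locally stochastic `Z`-noise `μ` of parameter `0 ≤ p < p₀` on the qubits `(A×A) ⊕ (B×B)` of `Q_G`, the total
weight of the `Z`-errors that `D_Z` does not correct is `≤ C n (p/p₀)^{C'√n}`, `n = n_A² + n_B²` (the `X`-sector
theorem for `Gᵀ`, `fgl18_theorem1_transpose`, transported along the block swap; same constants as `fgl18_theorem1_minmax`
with the degrees exchanged). [cite: FawziGrospellierLeverrier2018, Thm 1 (§1, arXiv v2 p0004) with §2.3 (X- and Z-decoding algorithms; p0008 L1-6)] -/
theorem fgl18_theorem1_zsector :
    ∀ (dA dB : ℕ) (γA δA γB δB : ℝ), 0 < dA → 0 < dB → 0 < γA → 0 < δA → 0 < γB → 0 < δB →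
      0 < betaZero dA dB δA δB →
      ∃ (p₀ C C' : ℝ), 0 < p₀ ∧ 0 < C' ∧
        ∀ (A B : Type) [Fintype A] [Fintype B] [DecidableEq A] [DecidableEq B]
          (H : Matrix B A (ZMod 2)),
          IsBiregular H dA dB → IsLeftRightExpanding H dA dB γA δA γB δB →
          ∀ κ : ℝ, κ ≤ betaZero (min dA dB) (max dA dB) δA δB * ((max dA dB : ℕ) : ℝ) →
          ∀ D : Decoder (B × A → ZMod 2) ((A × A) ⊕ (B × B) → ZMod 2),
            IsSSFDecoder κ (expanderHZ H) (expanderHX H) D →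
            ∀ (p : ℝ) (μ : Finset ((A × A) ⊕ (B × B)) → ℝ), 0 ≤ p → p < p₀ →
              IsLocallyStochastic μ p →
              (∑ E ∈ univ.filter (fun E : Finset ((A × A) ⊕ (B × B)) =>
                  ¬ D.Corrects (fun x => expanderHZ H *ᵥ x) (rowSpace (expanderHX H) : Set _)
                    (flipVec E)), μ E) ≤
                C * ((Fintype.card A : ℝ) ^ 2 + (Fintype.card B : ℝ) ^ 2) *
                  (p / p₀) ^ (C' * Real.sqrt ((Fintype.card A : ℝ) ^ 2 + (Fintype.card B : ℝ) ^ 2)) := by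
  intro dA dB γA δA γB δB hdA hdB hγA hδA hγB hδB hβ
  obtain ⟨p₀, C, C', hp₀, hC', htr⟩ :=
    fgl18_theorem1_transpose dA dB γA δA γB δB hdA hdB hγA hδA hγB hδB hβ
  refine ⟨p₀, C, C', hp₀, hC', ?_⟩
  intro A B _ _ _ _ H hreg hexp κ hκ D hD p μ hp0 hp hμ
  classical
  set σ := Equiv.sumComm (A × A) (B × B) with hσ
  rw [expanderHZ_eq_submatrix_swap H, expanderHX_eq_submatrix_swap H] at hD ⊢
  have hD' := isSSFDecoder_comp_equiv σ hD
  have hμ' := isLocallyStochastic_map_equiv σ hμ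
  have h := htr A B H hreg hexp κ hκ _ hD' p _ hp0 hp hμ'
  rw [sum_filter_not_corrects_map_equiv σ D μ]
  exact h

/-! ### Both sectors at once: a union bound -/

open Classical in
/-- **FGL18 Theorem 1 for the CODE `Q_G` decoded sector-wise (union bound over the two sectors).** For fixed
degrees and expansion parameters with `β₀ > 0` there are `p₀ > 0`, `C`, `C' > 0` such that for EVERY biregular
expanding `G`, every `κ ≤ β̃·max(Δ_A,Δ_B)`, every pair of small-set-flip decoders — `D_X` for (syndromes
`expanderHX H`, generators `expanderHZ H`) and `D_Z` for (syndromes `expanderHZ H`, generators `expanderHX H`) — and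
every nonnegative joint weight `ν` on pairs `(E_X, E_Z)` of error sets whose two MARGINALS are locally stochastic of
parameter `0 ≤ p < p₀` (`Σ_{(E_X,E_Z) : T ⊆ E_X} ν ≤ p^|T|` and likewise for `E_Z`; independent `X`/`Z` noise and the
`X`/`Z` parts of depolarizing-type noise are examples), the total `ν`-weight of the pairs on which `D_X` fails on
`E_X` or `D_Z` fails on `E_Z` is at most `2·C·n·(p/p₀)^{C'√n}`, `n = n_A² + n_B²` ("a decoding algorithm is given by an
`X`-decoding algorithm … and a `Z`-decoding algorithm"). [cite: FawziGrospellierLeverrier2018, Thm 1 (§1, arXiv v2 p0004) with §2.3 (p0008 L1-6)] -/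
theorem fgl18_theorem1_both_sectors :
    ∀ (dA dB : ℕ) (γA δA γB δB : ℝ), 0 < dA → 0 < dB → 0 < γA → 0 < δA → 0 < γB → 0 < δB →
      0 < betaZero dA dB δA δB →
      ∃ (p₀ C C' : ℝ), 0 < p₀ ∧ 0 < C' ∧
        ∀ (A B : Type) [Fintype A] [Fintype B] [DecidableEq A] [DecidableEq B]
          (H : Matrix B A (ZMod 2)),
          IsBiregular H dA dB → IsLeftRightExpanding H dA dB γA δA γB δB →
          ∀ κ : ℝ, κ ≤ betaZero (min dA dB) (max dA dB) δA δB * ((max dA dB : ℕ) : ℝ) →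
          ∀ (DX : Decoder (A × B → ZMod 2) ((A × A) ⊕ (B × B) → ZMod 2))
            (DZ : Decoder (B × A → ZMod 2) ((A × A) ⊕ (B × B) → ZMod 2)),
            IsSSFDecoder κ (expanderHX H) (expanderHZ H) DX →
            IsSSFDecoder κ (expanderHZ H) (expanderHX H) DZ →
            ∀ (p : ℝ) (ν : Finset ((A × A) ⊕ (B × B)) × Finset ((A × A) ⊕ (B × B)) → ℝ),
              0 ≤ p → p < p₀ → (∀ P, 0 ≤ ν P) →
              (∀ T : Finset ((A × A) ⊕ (B × B)), ∑ P ∈ univ.filter (fun P => T ⊆ P.1), ν P ≤ p ^ T.card) →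
              (∀ T : Finset ((A × A) ⊕ (B × B)), ∑ P ∈ univ.filter (fun P => T ⊆ P.2), ν P ≤ p ^ T.card) →
              (∑ P ∈ univ.filter (fun P : Finset ((A × A) ⊕ (B × B)) × Finset ((A × A) ⊕ (B × B)) =>
                  ¬ (DX.Corrects (fun x => expanderHX H *ᵥ x) (rowSpace (expanderHZ H) : Set _) (flipVec P.1) ∧
                     DZ.Corrects (fun x => expanderHZ H *ᵥ x) (rowSpace (expanderHX H) : Set _) (flipVec P.2))),
                  ν P) ≤
                2 * (C * ((Fintype.card A : ℝ) ^ 2 + (Fintype.card B : ℝ) ^ 2) *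
                  (p / p₀) ^ (C' * Real.sqrt ((Fintype.card A : ℝ) ^ 2 + (Fintype.card B : ℝ) ^ 2))) := by
  intro dA dB γA δA γB δB hdA hdB hγA hδA hγB hδB hβ
  obtain ⟨p₁, C₁, C₁', hp₁, hC₁', hX⟩ := fgl18_theorem1_minmax dA dB γA δA γB δB hdA hdB hγA hδA hγB hδB hβ
  obtain ⟨p₂, C₂, C₂', hp₂, hC₂', hZ⟩ := fgl18_theorem1_zsector dA dB γA δA γB δB hdA hdB hγA hδA hγB hδB hβ
  -- common constants: `p₀ = min p₁ p₂`, `C = max C₁ C₂` (made nonnegative), `C' = min C₁' C₂'`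
  refine ⟨min p₁ p₂, max (max C₁ C₂) 0, min C₁' C₂', lt_min hp₁ hp₂, lt_min hC₁' hC₂', ?_⟩
  intro A B _ _ _ _ H hreg hexp κ hκ DX DZ hDX hDZ p ν hp0 hp hν0 hν1 hν2
  classical
  set n : ℝ := (Fintype.card A : ℝ) ^ 2 + (Fintype.card B : ℝ) ^ 2 with hn
  have hn0 : 0 ≤ n := by positivity
  -- the two marginals
  set μX : Finset ((A × A) ⊕ (B × B)) → ℝ := fun E => ∑ P ∈ univ.filter (fun P : Finset ((A × A) ⊕ (B × B)) × Finset ((A × A) ⊕ (B × B)) => P.1 = E), ν P with hμX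
  set μZ : Finset ((A × A) ⊕ (B × B)) → ℝ := fun E => ∑ P ∈ univ.filter (fun P : Finset ((A × A) ⊕ (B × B)) × Finset ((A × A) ⊕ (B × B)) => P.2 = E), ν P with hμZ
  have hmargX : ∀ S : Finset (Finset ((A × A) ⊕ (B × B))),
      ∑ E ∈ S, μX E = ∑ P ∈ univ.filter (fun P : Finset ((A × A) ⊕ (B × B)) × Finset ((A × A) ⊕ (B × B)) => P.1 ∈ S), ν P := by
    intro S
    rw [← Finset.sum_fiberwise_of_maps_to (s := univ.filter (fun P : Finset ((A × A) ⊕ (B × B)) × Finset ((A × A) ⊕ (B × B)) => P.1 ∈ S)) (t := S)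
      (g := fun P => P.1) (fun P hP => (Finset.mem_filter.1 hP).2)]
    refine Finset.sum_congr rfl fun E hE => ?_
    rw [hμX, Finset.filter_filter]
    refine Finset.sum_congr ?_ fun _ _ => rfl
    ext P
    simp only [Finset.mem_filter, Finset.mem_univ, true_and]
    exact ⟨fun h => ⟨by rw [h]; exact hE, h⟩, fun h => h.2⟩
  have hmargZ : ∀ S : Finset (Finset ((A × A) ⊕ (B × B))),
      ∑ E ∈ S, μZ E = ∑ P ∈ univ.filter (fun P : Finset ((A × A) ⊕ (B × B)) × Finset ((A × A) ⊕ (B × B)) => P.2 ∈ S), ν P := by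
    intro S
    rw [← Finset.sum_fiberwise_of_maps_to (s := univ.filter (fun P : Finset ((A × A) ⊕ (B × B)) × Finset ((A × A) ⊕ (B × B)) => P.2 ∈ S)) (t := S)
      (g := fun P => P.2) (fun P hP => (Finset.mem_filter.1 hP).2)]
    refine Finset.sum_congr rfl fun E hE => ?_
    rw [hμZ, Finset.filter_filter]
    refine Finset.sum_congr ?_ fun _ _ => rfl
    ext P
    simp only [Finset.mem_filter, Finset.mem_univ, true_and]
    exact ⟨fun h => ⟨by rw [h]; exact hE, h⟩, fun h => h.2⟩
  have hμXls : IsLocallyStochastic μX p := by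
    refine ⟨fun E => Finset.sum_nonneg fun P _ => hν0 P, fun T => ?_⟩
    rw [hmargX]
    have : univ.filter (fun P : Finset ((A × A) ⊕ (B × B)) × Finset ((A × A) ⊕ (B × B)) => P.1 ∈ univ.filter (fun E => T ⊆ E))
        = univ.filter (fun P => T ⊆ P.1) := by
      ext P; simp
    rw [this]; exact hν1 T
  have hμZls : IsLocallyStochastic μZ p := by
    refine ⟨fun E => Finset.sum_nonneg fun P _ => hν0 P, fun T => ?_⟩
    rw [hmargZ]
    have : univ.filter (fun P : Finset ((A × A) ⊕ (B × B)) × Finset ((A × A) ⊕ (B × B)) => P.2 ∈ univ.filter (fun E => T ⊆ E))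
        = univ.filter (fun P => T ⊆ P.2) := by
      ext P; simp
    rw [this]; exact hν2 T
  -- failure events
  set FX : Finset (Finset ((A × A) ⊕ (B × B))) := univ.filter (fun E : Finset ((A × A) ⊕ (B × B)) =>
    ¬ DX.Corrects (fun x => expanderHX H *ᵥ x) (rowSpace (expanderHZ H) : Set _) (flipVec E)) with hFX
  set FZ : Finset (Finset ((A × A) ⊕ (B × B))) := univ.filter (fun E : Finset ((A × A) ⊕ (B × B)) =>
    ¬ DZ.Corrects (fun x => expanderHZ H *ᵥ x) (rowSpace (expanderHX H) : Set _) (flipVec E)) with hFZ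
  have hboundX : ∑ E ∈ FX, μX E ≤ C₁ * n * (p / p₁) ^ (C₁' * Real.sqrt n) :=
    hX A B H hreg hexp κ hκ DX hDX p μX hp0 (lt_of_lt_of_le hp (min_le_left _ _)) hμXls
  have hboundZ : ∑ E ∈ FZ, μZ E ≤ C₂ * n * (p / p₂) ^ (C₂' * Real.sqrt n) :=
    hZ A B H hreg hexp κ hκ DZ hDZ p μZ hp0 (lt_of_lt_of_le hp (min_le_right _ _)) hμZls
  -- union bound
  have hunion : ∑ P ∈ univ.filter (fun P : Finset ((A × A) ⊕ (B × B)) × Finset ((A × A) ⊕ (B × B)) =>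
        ¬ (DX.Corrects (fun x => expanderHX H *ᵥ x) (rowSpace (expanderHZ H) : Set _) (flipVec P.1) ∧
           DZ.Corrects (fun x => expanderHZ H *ᵥ x) (rowSpace (expanderHX H) : Set _) (flipVec P.2))), ν P
      ≤ ∑ E ∈ FX, μX E + ∑ E ∈ FZ, μZ E := by
    rw [hmargX, hmargZ, ← Finset.sum_union_inter]
    have hsub : univ.filter (fun P : Finset ((A × A) ⊕ (B × B)) × Finset ((A × A) ⊕ (B × B)) =>
        ¬ (DX.Corrects (fun x => expanderHX H *ᵥ x) (rowSpace (expanderHZ H) : Set _) (flipVec P.1) ∧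
           DZ.Corrects (fun x => expanderHZ H *ᵥ x) (rowSpace (expanderHX H) : Set _) (flipVec P.2)))
        ⊆ univ.filter (fun P : Finset ((A × A) ⊕ (B × B)) × Finset ((A × A) ⊕ (B × B)) => P.1 ∈ FX) ∪ univ.filter (fun P => P.2 ∈ FZ) := by
      intro P hP
      simp only [hFX, hFZ, Finset.mem_filter, Finset.mem_union, Finset.mem_univ, true_and] at hP ⊢
      tauto
    have h1 := Finset.sum_le_sum_of_subset_of_nonneg hsub (fun P _ _ => hν0 P)
    have h2 : 0 ≤ ∑ P ∈ univ.filter (fun P : Finset ((A × A) ⊕ (B × B)) × Finset ((A × A) ⊕ (B × B)) => P.1 ∈ FX) ∩ univ.filter (fun P => P.2 ∈ FZ), ν P :=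
      Finset.sum_nonneg fun P _ => hν0 P
    linarith
  -- compare the constants
  set C : ℝ := max (max C₁ C₂) 0 with hC
  set p₀ : ℝ := min p₁ p₂ with hp₀def
  set C' : ℝ := min C₁' C₂' with hC'
  have hp₀ : 0 < p₀ := lt_min hp₁ hp₂
  have hratio : 0 ≤ p / p₀ := div_nonneg hp0 hp₀.le
  have hratio1 : p / p₀ ≤ 1 := (div_le_one hp₀).2 hp.le
  have hmono : ∀ {pᵢ Cᵢ Cᵢ' : ℝ}, p₀ ≤ pᵢ → Cᵢ ≤ C → C' ≤ Cᵢ' → 0 < pᵢ →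
      Cᵢ * n * (p / pᵢ) ^ (Cᵢ' * Real.sqrt n) ≤ C * n * (p / p₀) ^ (C' * Real.sqrt n) := by
    intro pᵢ Cᵢ Cᵢ' hpi hCi hCi' hpi0
    have hri : 0 ≤ p / pᵢ := div_nonneg hp0 hpi0.le
    have hri' : p / pᵢ ≤ p / p₀ := div_le_div_of_nonneg_left hp0 hp₀ hpi
    have hexp0 : 0 ≤ C' * Real.sqrt n := mul_nonneg (lt_min hC₁' hC₂').le (Real.sqrt_nonneg _)
    have hexp1 : C' * Real.sqrt n ≤ Cᵢ' * Real.sqrt n := mul_le_mul_of_nonneg_right hCi' (Real.sqrt_nonneg _)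
    have hC0 : 0 ≤ C := le_max_right _ _
    calc Cᵢ * n * (p / pᵢ) ^ (Cᵢ' * Real.sqrt n)
        ≤ C * n * (p / pᵢ) ^ (Cᵢ' * Real.sqrt n) := by
          refine mul_le_mul_of_nonneg_right (mul_le_mul_of_nonneg_right hCi hn0) (Real.rpow_nonneg hri _)
      _ ≤ C * n * (p / p₀) ^ (Cᵢ' * Real.sqrt n) := by
          refine mul_le_mul_of_nonneg_left (Real.rpow_le_rpow hri hri' (hexp0.trans hexp1)) (mul_nonneg hC0 hn0)
      _ ≤ C * n * (p / p₀) ^ (C' * Real.sqrt n) := by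
          refine mul_le_mul_of_nonneg_left ?_ (mul_nonneg hC0 hn0)
          exact Real.rpow_le_rpow_of_exponent_ge' hratio hratio1 hexp0 hexp1
  have hXle := hmono (min_le_left p₁ p₂) ((le_max_left C₁ C₂).trans (le_max_left _ _)) (min_le_left _ _) hp₁
  have hZle := hmono (min_le_right p₁ p₂) ((le_max_right C₁ C₂).trans (le_max_left _ _)) (min_le_right _ _) hp₂
  calc _ ≤ ∑ E ∈ FX, μX E + ∑ E ∈ FZ, μZ E := hunion
    _ ≤ C * n * (p / p₀) ^ (C' * Real.sqrt n) + C * n * (p / p₀) ^ (C' * Real.sqrt n) :=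
        add_le_add (hboundX.trans hXle) (hboundZ.trans hZle)
    _ = 2 * (C * n * (p / p₀) ^ (C' * Real.sqrt n)) := by ring

/-! ### i.i.d. depolarizing noise -/

section Depolarizing

/-- In `𝔽₂` a non-zero element is `1`. [folklore] -/
private theorem zmod2_eq_one_of_ne_zero'' {z : ZMod 2} (h : z ≠ 0) : z = 1 := by
  revert z; decide

/-- `𝟙_{supp x} = x`. [folklore] -/
private theorem flipVec_supp {Q : Type*} [Fintype Q] [DecidableEq Q] (x : Q → ZMod 2) :
    flipVec (supp x) = x := by
  funext q
  simp only [flipVec, supp, Finset.mem_filter, Finset.mem_univ, true_and]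
  by_cases h : x q = 0
  · simp [h]
  · rw [if_pos h, zmod2_eq_one_of_ne_zero'' h]

/-- `supp 𝟙_E = E`. [folklore] -/
private theorem supp_flipVec {Q : Type*} [Fintype Q] [DecidableEq Q] (E : Finset Q) :
    supp (flipVec E) = E := by
  ext q
  simp [supp, flipVec]

/-- Re-indexing a sum over binary vectors by their supports. [folklore] -/
private theorem sum_filter_supp_eq {Q : Type*} [Fintype Q] [DecidableEq Q] (P : (Q → ZMod 2) → Prop)
    [DecidablePred P] [DecidablePred fun E : Finset Q => P (flipVec E)] (w : Finset Q → ℝ) :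
    ∑ x ∈ univ.filter P, w (supp x) = ∑ E ∈ univ.filter (fun E : Finset Q => P (flipVec E)), w E := by
  refine Finset.sum_nbij' supp flipVec ?_ ?_ ?_ ?_ ?_
  · intro x hx
    rw [Finset.mem_filter] at hx ⊢
    exact ⟨Finset.mem_univ _, by rw [flipVec_supp]; exact hx.2⟩
  · intro E hE
    rw [Finset.mem_filter] at hE ⊢
    exact ⟨Finset.mem_univ _, hE.2⟩
  · intro x _; exact flipVec_supp x
  · intro E _; exact supp_flipVec E
  · intro x _; rfl

open Classical in
/-- **FGL18 Theorem 1 under i.i.d. DEPOLARIZING noise (sector-wise small-set-flip decoding; union bound through the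
marginals).** For fixed degrees and expansion parameters with `β₀ > 0` there are `p₀ > 0`, `C`, `C' > 0` such that for
every biregular expanding `G`, every `κ ≤ β̃·max(Δ_A,Δ_B)` and every pair of small-set-flip decoders — `D₁` with syndromes
`expanderHZ H` and flips inside the rows of `expanderHX H` (the `X`-error decoder of the CSS code
`CSSCode.ofMatrices (expanderHX H) (expanderHZ H)` in the tree's `CSSCode` conventions) and `D₂` with syndromes
`expanderHX H` and flips inside the rows of `expanderHZ H` (its `Z`-error decoder) — and every depolarizing rate `p`
with `0 ≤ p ≤ 1` and `2p/3 < p₀`: `P_fail^depol(p) ≤ 2·C·n·((2p/3)/p₀)^{C'√n}`, `n = n_A² + n_B²` ("the `X`-type errors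
(resp. `Z`-type errors) produced by a depolarizing channel … are independent with parameter `2p/3`", FGL18 §2.4 after
Def 7). [cite: FawziGrospellierLeverrier2018, Thm 1 (§1, arXiv v2 p0004) and §2.4 (remark after Def 7: depolarizing marginals 2p/3, p0010 L23)] -/
theorem fgl18_theorem1_depolarizing :
    ∀ (dA dB : ℕ) (γA δA γB δB : ℝ), 0 < dA → 0 < dB → 0 < γA → 0 < δA → 0 < γB → 0 < δB →
      0 < betaZero dA dB δA δB →
      ∃ (p₀ C C' : ℝ), 0 < p₀ ∧ 0 < C' ∧
        ∀ (A B : Type) [Fintype A] [Fintype B] [DecidableEq A] [DecidableEq B]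
          (H : Matrix B A (ZMod 2)),
          IsBiregular H dA dB → IsLeftRightExpanding H dA dB γA δA γB δB →
          ∀ κ : ℝ, κ ≤ betaZero (min dA dB) (max dA dB) δA δB * ((max dA dB : ℕ) : ℝ) →
          ∀ (D₁ : Decoder (B × A → ZMod 2) ((A × A) ⊕ (B × B) → ZMod 2))
            (D₂ : Decoder (A × B → ZMod 2) ((A × A) ⊕ (B × B) → ZMod 2)),
            IsSSFDecoder κ (expanderHZ H) (expanderHX H) D₁ →
            IsSSFDecoder κ (expanderHX H) (expanderHZ H) D₂ →
            ∀ p : ℝ, 0 ≤ p → p ≤ 1 → 2 * p / 3 < p₀ →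
              (CSSCode.ofMatrices (expanderHX H) (expanderHZ H)
                  (expanderHX_mul_expanderHZ_transpose H)).depolarizingFailureProb D₁ D₂ p ≤
                2 * (C * ((Fintype.card A : ℝ) ^ 2 + (Fintype.card B : ℝ) ^ 2) *
                  ((2 * p / 3) / p₀) ^ (C' * Real.sqrt ((Fintype.card A : ℝ) ^ 2 + (Fintype.card B : ℝ) ^ 2))) := by
  intro dA dB γA δA γB δB hdA hdB hγA hδA hγB hδB hβ
  obtain ⟨p₁, C₁, C₁', hp₁, hC₁', h1⟩ := fgl18_theorem1_zsector dA dB γA δA γB δB hdA hdB hγA hδA hγB hδB hβ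
  obtain ⟨p₂, C₂, C₂', hp₂, hC₂', h2⟩ := fgl18_theorem1_minmax dA dB γA δA γB δB hdA hdB hγA hδA hγB hδB hβ
  refine ⟨min p₁ p₂, max (max C₁ C₂) 0, min C₁' C₂', lt_min hp₁ hp₂, lt_min hC₁' hC₂', ?_⟩
  intro A B _ _ _ _ H hreg hexp κ hκ D₁ D₂ hD₁ hD₂ p hp0 hp1 hp
  classical
  set n : ℝ := (Fintype.card A : ℝ) ^ 2 + (Fintype.card B : ℝ) ^ 2 with hn
  have hn0 : 0 ≤ n := by positivity
  set r : ℝ := 2 * p / 3 with hr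
  have hr0 : 0 ≤ r := by rw [hr]; positivity
  have hr1 : r ≤ 1 := by rw [hr]; linarith
  set Cc := CSSCode.ofMatrices (expanderHX H) (expanderHZ H) (expanderHX_mul_expanderHZ_transpose H) with hCc
  have hμ : IsLocallyStochastic (bernoulliWeight (V := (A × A) ⊕ (B × B)) r) r :=
    isLocallyStochastic_bernoulliWeight hr0 hr1
  -- the union bound through the marginals
  have hub := CSSCode.depolarizingFailureProb_le Cc D₁ D₂ hp0 hp1
  -- the two marginal failure probabilities, re-indexed by supports, are FGL sums
  have hS1 : (∑ x ∈ univ.filter (fun x : (A × A) ⊕ (B × B) → ZMod 2 =>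
        ¬ D₁.Corrects Cc.xSyndrome (Cc.rowSpX : Set ((A × A) ⊕ (B × B) → ZMod 2)) x),
          bernoulliWeight (2 * p / 3) (supp x))
      = ∑ E ∈ univ.filter (fun E : Finset ((A × A) ⊕ (B × B)) =>
          ¬ D₁.Corrects (fun x => expanderHZ H *ᵥ x) (rowSpace (expanderHX H) : Set _) (flipVec E)),
          bernoulliWeight r E := by
    rw [hr]
    exact sum_filter_supp_eq (fun x => ¬ D₁.Corrects Cc.xSyndrome (Cc.rowSpX : Set ((A × A) ⊕ (B × B) → ZMod 2)) x) _
  have hS2 : (∑ z ∈ univ.filter (fun z : (A × A) ⊕ (B × B) → ZMod 2 =>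
        ¬ D₂.Corrects Cc.zSyndrome (Cc.rowSpZ : Set ((A × A) ⊕ (B × B) → ZMod 2)) z),
          bernoulliWeight (2 * p / 3) (supp z))
      = ∑ E ∈ univ.filter (fun E : Finset ((A × A) ⊕ (B × B)) =>
          ¬ D₂.Corrects (fun x => expanderHX H *ᵥ x) (rowSpace (expanderHZ H) : Set _) (flipVec E)),
          bernoulliWeight r E := by
    rw [hr]
    exact sum_filter_supp_eq (fun z => ¬ D₂.Corrects Cc.zSyndrome (Cc.rowSpZ : Set ((A × A) ⊕ (B × B) → ZMod 2)) z) _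
  have hb1 := h1 A B H hreg hexp κ hκ D₁ hD₁ r _ hr0 (lt_of_lt_of_le hp (min_le_left _ _)) hμ
  have hb2 := h2 A B H hreg hexp κ hκ D₂ hD₂ r _ hr0 (lt_of_lt_of_le hp (min_le_right _ _)) hμ
  -- compare the constants
  set C : ℝ := max (max C₁ C₂) 0 with hC
  set p₀ : ℝ := min p₁ p₂ with hp₀def
  set C' : ℝ := min C₁' C₂' with hC'
  have hp₀ : 0 < p₀ := lt_min hp₁ hp₂
  have hratio : 0 ≤ r / p₀ := div_nonneg hr0 hp₀.le
  have hratio1 : r / p₀ ≤ 1 := (div_le_one hp₀).2 hp.le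
  have hmono : ∀ {pᵢ Cᵢ Cᵢ' : ℝ}, p₀ ≤ pᵢ → Cᵢ ≤ C → C' ≤ Cᵢ' → 0 < pᵢ →
      Cᵢ * n * (r / pᵢ) ^ (Cᵢ' * Real.sqrt n) ≤ C * n * (r / p₀) ^ (C' * Real.sqrt n) := by
    intro pᵢ Cᵢ Cᵢ' hpi hCi hCi' hpi0
    have hri : 0 ≤ r / pᵢ := div_nonneg hr0 hpi0.le
    have hri' : r / pᵢ ≤ r / p₀ := div_le_div_of_nonneg_left hr0 hp₀ hpi
    have hexp0 : 0 ≤ C' * Real.sqrt n := mul_nonneg (lt_min hC₁' hC₂').le (Real.sqrt_nonneg _)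
    have hexp1 : C' * Real.sqrt n ≤ Cᵢ' * Real.sqrt n := mul_le_mul_of_nonneg_right hCi' (Real.sqrt_nonneg _)
    have hC0 : 0 ≤ C := le_max_right _ _
    calc Cᵢ * n * (r / pᵢ) ^ (Cᵢ' * Real.sqrt n)
        ≤ C * n * (r / pᵢ) ^ (Cᵢ' * Real.sqrt n) := by
          refine mul_le_mul_of_nonneg_right (mul_le_mul_of_nonneg_right hCi hn0) (Real.rpow_nonneg hri _)
      _ ≤ C * n * (r / p₀) ^ (Cᵢ' * Real.sqrt n) := by
          refine mul_le_mul_of_nonneg_left (Real.rpow_le_rpow hri hri' (hexp0.trans hexp1)) (mul_nonneg hC0 hn0)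
      _ ≤ C * n * (r / p₀) ^ (C' * Real.sqrt n) := by
          refine mul_le_mul_of_nonneg_left ?_ (mul_nonneg hC0 hn0)
          exact Real.rpow_le_rpow_of_exponent_ge' hratio hratio1 hexp0 hexp1
  have h1le := hmono (min_le_left p₁ p₂) ((le_max_left C₁ C₂).trans (le_max_left _ _)) (min_le_left _ _) hp₁
  have h2le := hmono (min_le_right p₁ p₂) ((le_max_right C₁ C₂).trans (le_max_left _ _)) (min_le_right _ _) hp₂
  calc Cc.depolarizingFailureProb D₁ D₂ p ≤ _ := hub
    _ = _ := by rw [hS1, hS2]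
    _ ≤ C * n * (r / p₀) ^ (C' * Real.sqrt n) + C * n * (r / p₀) ^ (C' * Real.sqrt n) :=
        add_le_add (hb1.trans h1le) (hb2.trans h2le)
    _ = 2 * (C * n * (r / p₀) ^ (C' * Real.sqrt n)) := by ring

end Depolarizing

/-! ### Appended (qec-type-04 g5, same session): LTZ15 Theorem 2 for the `Z`-sector of `Q_G` in its own coordinates

The adversarial radius of Algorithm 1 (`κ = 0`; Leverrier–Tillich–Zémor 2015 Thm 2 in the convention-free form
`QuantumExpander.ltz15_theorem2_max`, hypotheses `δ_A, δ_B < 1/6`) transported along the block swap exactly like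
`fgl18_proposition11_zsector`: the `Z`-sector decoders of `Q_G` (syndromes `expanderHZ H`, flips inside the rows of
`expanderHX H`) correct every error of weight `< min(γ_A n_A, γ_B n_B)/(3(1 + max(Δ_A,Δ_B)))`. -/

section LTZ

/-- **LTZ15 Theorem 2, `Z`-sector of `Q_G` in its own coordinates** (Algorithm 1, any tie-breaking): for a
`(Δ_A,Δ_B)`-biregular `(γ_A,δ_A,γ_B,δ_B)`-expanding `G` with `δ_A, δ_B < 1/6`, every small-set-flip decoder `D_Z` with
syndrome matrix `expanderHZ H` and generator matrix `expanderHX H` corrects every error of weight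
`< min(γ_A n_A, γ_B n_B)/(3(1 + max(Δ_A,Δ_B)))` ("the situation for `𝒢_Z` is obtained by exchanging the roles of `A`
and `B`": Theorem 2 for `Gᵀ`, transported along the swap). [cite: LeverrierTillichZemor2015, Thm 2 (arXiv v1 p0006) with §2 ("exchanging the roles of A and B"; p0005)] -/
theorem ltz15_theorem2_zsector (H : Matrix B A (ZMod 2)) {dA dB : ℕ} {γA δA γB δB : ℝ}
    (hreg : IsBiregular H dA dB) (hexp : IsLeftRightExpanding H dA dB γA δA γB δB)
    (hdA : 0 < dA) (hdB : 0 < dB) (hδA : 0 < δA) (hδA' : δA < 1 / 6) (hδB : 0 < δB) (hδB' : δB < 1 / 6)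
    (D : Decoder (B × A → ZMod 2) ((A × A) ⊕ (B × B) → ZMod 2))
    (hD : IsSSFDecoder 0 (expanderHZ H) (expanderHX H) D) (e : (A × A) ⊕ (B × B) → ZMod 2)
    (he : (hammingNorm e : ℝ)
      < 1 / (3 * (1 + (max dA dB : ℕ))) * min (γA * Fintype.card A) (γB * Fintype.card B)) :
    D.Corrects (fun x => expanderHZ H *ᵥ x)
      (rowSpace (expanderHX H) : Set ((A × A) ⊕ (B × B) → ZMod 2)) e := by
  set σ := Equiv.sumComm (A × A) (B × B) with hσ
  rw [expanderHZ_eq_submatrix_swap H, expanderHX_eq_submatrix_swap H] at hD ⊢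
  have hD' := isSSFDecoder_comp_equiv σ hD
  have hregT : IsBiregular Hᵀ dB dA := isBiregular_transpose H hreg
  have hexpT : IsLeftRightExpanding Hᵀ dB dA γB δB γA δA := by
    refine ⟨(isLeftExpanding_transpose_iff H dB γB δB).2 hexp.2, ?_⟩
    have h : IsLeftExpanding Hᵀᵀ dA γA δA := by rw [Matrix.transpose_transpose]; exact hexp.1
    exact (isLeftExpanding_transpose_iff Hᵀ dA γA δA).1 h
  have he' : (hammingNorm (e ∘ σ.symm) : ℝ)
      < 1 / (3 * (1 + (max dB dA : ℕ))) * min (γB * Fintype.card B) (γA * Fintype.card A) := by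
    rw [hammingNorm_comp_equiv' σ.symm e, max_comm, min_comm]; exact he
  have h := ltz15_theorem2_max Hᵀ hregT hexpT hdB hdA hδB hδB' hδA hδA' _ hD' (e ∘ σ.symm) he'
  exact (corrects_comp_equiv_iff σ D e).1 h

end LTZ

end QuantumExpander

end Literature.InformationTheory.QuantumCodes
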